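import Summits.KontsevichZagierPeriods.KontsevichZagierPeriods.Theorems.ValuedFieldSpecialisationClassLevelExpansionFibreDimOneFibreSubst

/-!
# Route ValuedFieldSpecialisation — reflection of the last coordinate; decreasing substitutions

Helper for item stmt-KontsevichZagierPeriods-3503 (`ClassLevelExpansionFibreDimOne`). The
reflection `(y, t) ↦ (y, −t)` of the last coordinate over a base of dimension `≥ 1` is a FIBRED
change of variables (linear, `|det| = 1`, the parameter coordinate `0` is a base coordinate):
`exists_reflect` produces, for any representation `r'`, its reflected representation `r` with
`[r] − [r'] ∈ fibredRelations`. Composed with the increasing fibrewise substitutions of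
`…FibreSubst` (`exists_fibreSubst_pullback`) this gives the pull-back along DECREASING fibrewise
substitutions `t ↦ ψ(y, t)` (`exists_fibreSubst_pullback_anti`): the Jacobian factor is `−∂ψ/∂t`.

Sources: M. Kontsevich, D. Zagier (2001), §1.2, rule (2). Deliberately NOT here: any particular
substitution.
-/

noncomputable section

namespace Summit.KontsevichZagierPeriods.ValuedFieldSpecialisation

open MeasureTheory Set Filter Function
open scoped Topology
open Literature.NumberTheory.Transcendental Literature.NumberTheory.Transcendental.KZ
open Literature.ModelTheory.ExponentialFields (IsSemialgebraic)

variable {m : ℕ}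

/-! ### The reflection as a continuous linear map -/

/-- The reflection `z ↦ (init z, −z last)` is the continuous linear map with components
`(proj 0, …, proj (m), −proj last)`. [folklore] -/
theorem reflectCLM_apply (z : Fin (m + 1 + 1) → ℝ) :
    (ContinuousLinearMap.pi (Fin.lastCases (motive := fun _ => (Fin (m + 1 + 1) → ℝ) →L[ℝ] ℝ)
        (-(ContinuousLinearMap.proj (R := ℝ) (Fin.last (m + 1))))
        (fun i => ContinuousLinearMap.proj (R := ℝ) (Fin.castSucc i))) :
      (Fin (m + 1 + 1) → ℝ) →L[ℝ] (Fin (m + 1 + 1) → ℝ)) z =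
      Fin.snoc (Fin.init z) (-z (Fin.last (m + 1))) := by
  ext j
  refine Fin.lastCases ?_ (fun i => ?_) j
  · simp
  · simp [Fin.init]

/-- The reflection has determinant `−1`. [folklore] -/
theorem det_reflectCLM :
    ((ContinuousLinearMap.pi (Fin.lastCases (motive := fun _ => (Fin (m + 1 + 1) → ℝ) →L[ℝ] ℝ)
        (-(ContinuousLinearMap.proj (R := ℝ) (Fin.last (m + 1))))
        (fun i => ContinuousLinearMap.proj (R := ℝ) (Fin.castSucc i))) :
      (Fin (m + 1 + 1) → ℝ) →L[ℝ] (Fin (m + 1 + 1) → ℝ))).det = -1 := by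
  rw [ContinuousLinearMap.det]
  rw [LinearMap.det_of_snoc_init _ LinearMap.id 0 (-1) fun w => ?_]
  · simp
  · rw [ContinuousLinearMap.coe_coe, reflectCLM_apply]
    simp

/-- The reflection is an involution. [folklore] -/
theorem reflect_reflect (z : Fin (m + 1 + 1) → ℝ) :
    (Fin.snoc (Fin.init (Fin.snoc (Fin.init z) (-z (Fin.last (m + 1))) : Fin (m + 1 + 1) → ℝ))
      (-(Fin.snoc (Fin.init z) (-z (Fin.last (m + 1))) : Fin (m + 1 + 1) → ℝ) (Fin.last (m + 1))) :
      Fin (m + 1 + 1) → ℝ) = z := by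
  simp

/-- The reflection as a polynomial map: components `X (castSucc i)` and `−X last`. [folklore] -/
theorem aeval_reflectPoly (z : Fin (m + 1 + 1) → ℝ) :
    (fun j => MvPolynomial.aeval z (Fin.lastCases (motive := fun _ => MvPolynomial (Fin (m + 1 + 1)) ℚ)
      (-MvPolynomial.X (Fin.last (m + 1))) (fun i => MvPolynomial.X (Fin.castSucc i)) j)) =
      Fin.snoc (Fin.init z) (-z (Fin.last (m + 1))) := by
  ext j
  refine Fin.lastCases ?_ (fun i => ?_) j
  · simp
  · simp [Fin.init]

/-- **Reflection of the last coordinate is a fibred change of variables.** For every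
representation `r'` of dimension `m + 2` there is a representation `r` with domain the reflected
domain and integrand `r'.integrand ∘ reflection`, and `[r] − [r'] ∈ fibredRelations`.
[Kontsevich–Zagier 2001, §1.2, rule (2)] [folklore] -/
theorem exists_reflect (r' : IntegralRep (m + 1 + 1)) :
    ∃ r : IntegralRep (m + 1 + 1),
      r.domain = {z | (Fin.snoc (Fin.init z) (-z (Fin.last (m + 1))) : Fin (m + 1 + 1) → ℝ) ∈ r'.domain} ∧
      (r.integrand = fun z => r'.integrand (Fin.snoc (Fin.init z) (-z (Fin.last (m + 1))))) ∧
      of r - of r' ∈ fibredRelations := by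
  set Φc : (Fin (m + 1 + 1) → ℝ) →L[ℝ] (Fin (m + 1 + 1) → ℝ) :=
    ContinuousLinearMap.pi (Fin.lastCases (motive := fun _ => (Fin (m + 1 + 1) → ℝ) →L[ℝ] ℝ)
      (-(ContinuousLinearMap.proj (R := ℝ) (Fin.last (m + 1))))
      (fun i => ContinuousLinearMap.proj (R := ℝ) (Fin.castSucc i))) with hΦc
  set Φ : (Fin (m + 1 + 1) → ℝ) → (Fin (m + 1 + 1) → ℝ) :=
    fun z => Fin.snoc (Fin.init z) (-z (Fin.last (m + 1))) with hΦ
  have hΦc_apply : ∀ z, Φc z = Φ z := fun z => reflectCLM_apply z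
  have hinv : ∀ z, Φ (Φ z) = z := fun z => reflect_reflect z
  set D : Set (Fin (m + 1 + 1) → ℝ) := {z | Φ z ∈ r'.domain} with hD
  have hDsa : IsSemialgebraic ℚ D := by
    have := r'.isSemialgebraic_domain.preimage_aeval
      (Fin.lastCases (motive := fun _ => MvPolynomial (Fin (m + 1 + 1)) ℚ)
        (-MvPolynomial.X (Fin.last (m + 1))) (fun i => MvPolynomial.X (Fin.castSucc i)))
    convert this using 1
    ext z
    simp only [hD, mem_setOf_eq, mem_preimage, aeval_reflectPoly]
    exact Iff.rfl
  have hmap : IsSemialgebraicMapOn ℚ D Φ := by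
    refine IsSemialgebraicMapOn.of_forall hDsa fun j => ?_
    have := isSemialgebraicFunOn_aeval hDsa
      (Fin.lastCases (motive := fun _ => MvPolynomial (Fin (m + 1 + 1)) ℚ)
        (-MvPolynomial.X (Fin.last (m + 1))) (fun i => MvPolynomial.X (Fin.castSucc i)) j)
    refine this.congr fun z _ => ?_
    show MvPolynomial.aeval z _ = Φ z j
    exact congrFun (aeval_reflectPoly z) j
  have himg : Φ '' D = r'.domain := by
    ext w
    constructor
    · rintro ⟨z, hz, rfl⟩; exact hz
    · intro hw
      exact ⟨Φ w, by show Φ (Φ w) ∈ r'.domain; rwa [hinv], hinv w⟩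
  have hinj : InjOn Φ D := fun z _ w _ h => by rw [← hinv z, ← hinv w]; exact congrArg Φ h
  have hderiv : ∀ z ∈ D, HasFDerivWithinAt Φ Φc D z := fun z _ => by
    have : HasFDerivAt (fun z => Φc z) Φc z := Φc.hasFDerivAt
    exact (this.congr_of_eventuallyEq (Eventually.of_forall fun w => (hΦc_apply w).symm) |>.hasFDerivWithinAt)
  have hdet : |Φc.det| = 1 := by rw [hΦc, det_reflectCLM]; norm_num
  have hDm : MeasurableSet D := IsSemialgebraic.measurableSet_holds hDsa
  -- the reflected representation
  have hfsa : IsSemialgebraicFunOn ℚ D (fun z => r'.integrand (Φ z)) :=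
    IsSemialgebraicFunOn.comp_isSemialgebraicMapOn_holds r'.isSemialgebraicFunOn_integrand hmap
      (fun z hz => hz)
  have hint : IntegrableOn (fun z => r'.integrand (Φ z)) D := by
    have h := (integrableOn_image_iff_integrableOn_abs_det_fderiv_smul volume hDm hderiv hinj
      r'.integrand).mp (by rw [himg]; exact r'.integrableOn)
    refine h.congr_fun (fun z _ => ?_) hDm
    simp [hdet]
  refine ⟨⟨D, _, hDsa, hfsa, hint⟩, rfl, rfl, ?_⟩
  refine mem_fibredRelations_of_mem_fibredChangeOfVariablesRel
    ⟨m + 1, ⟨D, _, hDsa, hfsa, hint⟩, r', Φ, fun _ => Φc, hmap, hderiv, hinj, himg.symm,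
      fun z _ => by simp [hdet], fun z _ => ?_, rfl⟩
  show (Fin.snoc (Fin.init z) (-z (Fin.last (m + 1))) : Fin (m + 1 + 1) → ℝ) 0 = z 0
  have : (0 : Fin (m + 1 + 1)) = Fin.castSucc (0 : Fin (m + 1)) := rfl
  rw [this, Fin.snoc_castSucc]
  rfl

/-- **Pulling back along a decreasing fibrewise substitution.** As `exists_fibreSubst_pullback`,
with `t ↦ ψ(y, t)` strictly DECREASING on `[a y, b y]` and `∂ψ/∂t < 0` on the band: the image band
is `[ψ(y, b y), ψ(y, a y)]`, the pulled-back integrand is `r'.integrand (y, ψ(y, t)) · (−∂ψ/∂t)`.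
[Kontsevich–Zagier 2001, §1.2, rule (2)] [folklore] -/
theorem exists_fibreSubst_pullback_anti {G : Set (Fin (m + 1) → ℝ)}
    {a b : (Fin (m + 1) → ℝ) → ℝ} (ha : IsSemialgebraicFunOn ℚ G a)
    (hb : IsSemialgebraicFunOn ℚ G b) (hab : ∀ y ∈ G, a y ≤ b y)
    {ψ : (Fin (m + 1 + 1) → ℝ) → ℝ} {U : Set (Fin (m + 1 + 1) → ℝ)} (hUo : IsOpen U)
    (hBU : KZlog.band G a b ⊆ U) (hψsa : IsSemialgebraicFunOn ℚ (KZlog.band G a b) ψ)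
    (hψd : DifferentiableOn ℝ ψ U)
    (hψ'sa : IsSemialgebraicFunOn ℚ (KZlog.band G a b)
      (fun z => fderiv ℝ ψ z (Pi.single (Fin.last (m + 1)) 1)))
    (hψneg : ∀ z ∈ KZlog.band G a b, fderiv ℝ ψ z (Pi.single (Fin.last (m + 1)) 1) < 0)
    (hψanti : ∀ y ∈ G, StrictAntiOn (fun t : ℝ => ψ (Fin.snoc y t)) (Icc (a y) (b y)))
    (r' : IntegralRep (m + 1 + 1))
    (hr' : r'.domain = KZlog.band G (fun y => ψ (Fin.snoc y (b y))) (fun y => ψ (Fin.snoc y (a y)))) :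
    ∃ r : IntegralRep (m + 1 + 1), r.domain = KZlog.band G a b ∧
      (r.integrand = fun z => r'.integrand (Fin.snoc (Fin.init z) (ψ z)) *
        (-fderiv ℝ ψ z (Pi.single (Fin.last (m + 1)) 1))) ∧
      of r - of r' ∈ fibredRelations := by
  -- reflect `r'`
  obtain ⟨r₁, hr₁d, hr₁i, hr₁rel⟩ := exists_reflect r'
  have hr₁d' : r₁.domain = KZlog.band G (fun y => (-ψ) (Fin.snoc y (a y))) (fun y => (-ψ) (Fin.snoc y (b y))) := by
    rw [hr₁d, hr']
    ext z
    simp only [mem_setOf_eq, KZlog.mem_band, Fin.init_snoc, Fin.snoc_last, Pi.neg_apply]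
    constructor
    · rintro ⟨hG, h1, h2⟩; exact ⟨hG, by linarith, by linarith⟩
    · rintro ⟨hG, h1, h2⟩; exact ⟨hG, by linarith, by linarith⟩
  -- pull back along the increasing `−ψ`
  have hψ'eq : ∀ z, fderiv ℝ (-ψ) z (Pi.single (Fin.last (m + 1)) 1) =
      -fderiv ℝ ψ z (Pi.single (Fin.last (m + 1)) 1) := by
    intro z
    rw [fderiv_neg]
    rfl
  obtain ⟨r, hrd, hri, hrrel⟩ := exists_fibreSubst_pullback ha hb hab hUo hBU hψsa.neg hψd.neg
    ((hψ'sa.neg).congr fun z _ => by rw [Pi.neg_apply, hψ'eq z])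
    (fun z hz => by rw [hψ'eq z]; linarith [hψneg z hz])
    (fun y hy => (hψanti y hy).neg) r₁ hr₁d'
  refine ⟨r, hrd, ?_, ?_⟩
  · rw [hri, hr₁i]
    funext z
    simp only [Fin.init_snoc, Fin.snoc_last, Pi.neg_apply, neg_neg, hψ'eq z]
  · have : of r - of r' = (of r - of r₁) + (of r₁ - of r') := by abel
    rw [this]
    exact fibredRelations.add_mem hrrel hr₁rel

end Summit.KontsevichZagierPeriods.ValuedFieldSpecialisation
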